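import Summits.QuantumFields.YangMills.Theorems.BalabanUVNodesN07DbarNearRowsQA
import Summits.QuantumFields.YangMills.Theorems.BalabanUVNodesN07DatumGauge152Guarded
import HarnessLib

/-!
# N07 [B11] (= [15] = [Balaban1985Variational]) Sect. F — MODULE 99: **(c′)‴ DISCHARGED IN BINDER FORM — the (c′) letter `hQnear` of MODULES 82b∕89″∕90″ (the near rows of the block
# averages `Q_{j(c)}A(c)` on MODULE 77b's near class) PROVED from the K0 assembler's numerics, at `β₁ ε δ j := L·(2·X₀·δ_j + 64·60800·ℓ²·(κ·ε_j·L)²)`** — so the guarded [15] Prop. 8 step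
# token of record `prop8RegSepTopStepG_of_hThm4RecDbar_of_letters` (90″) now reads: `HThm4RecDbar` (N05-REC) + (d′) `hA1` + ONE budget row; (c′) is no longer a hypothesis

Cell `pub-ymgap`, seat `pub-ymgap-dag-n07-e` g28 (FAN-OUT §N07 row s3; LANE OWNER of the K0 road chart side), MODULE 99 (INTENT-99, cell bus; plan (α⁗-W) step 6 = the END of (c′)‴).
`--kind proof --supports stmt-QuantumFields-20541 --as helper` (K0⁷); count-neutral; ONE theorem (0 `def`).  [15] = [Balaban1985Variational]; [3] = [Balaban1985Averaging];
[6] = [Balaban1985RegularSpaces]; [4] = [Balaban1984PropagatorsII]; [III] = [Balaban1988Convergent]; [I] = [Balaban1987RG1].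

WHY.  MODULE 98 proves the near row for every near-class cell under MODULE 80-style hypotheses; 90″'s binder `hQnear` quantifies over the run, the tolerances, the data, the field, the
datum and S3's gauge `(u, A)` with the door's rows.  This file is the ADAPTER: it derives 98's side conditions from the binder's own prefix — `k ≤ m + K`, the grid numerics and the floor
`(11d + 4ρ + Mc)·L + 3 ≤ ν.M₁` from the guard `Adm` (its two displayed consequences, 77c∕90″'s binders), the level room `j + 1 ≤ m + K` and the window's non-wrapping
`tHi − tLo + 1 < sitesPerDir j` from the level guard `k + c₀ ≤ m + K` with `Mc + 44 + 6ρ + 1 ≤ 2·L^{c₀}` (STRICT by one: the window `[tLo, tHi]` has `sideP + 4ρ ≤ Mc + 44 + 6ρ` sites per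
direction and must not wrap — typing guard (g1)), `Adm22 D̃ R (L·M_h)` from MODULE 93's named instance with `numerics_cornerP_of_levelGuard`, the sign `0 ≤ ε_j` from `B₃·δ_j ≤ ε_j`, and the
dictionary ∕ UST budgets at `ε_j ≤ a₀` from the two guards on `a₀` — and reads the conclusion of 98 at `β₁`.

WHAT IS PROVED (sorry-free; axioms standard).  ★★★ `hQnear_dbar_of_guards (F N)` : under the structural letters of 90″ (`Mc, M_h = L^{a′}, R, ρ, c, c₀` with `L·M_h ∣ ρ`, `R·L·M_h ≤ ρ`,
`L ≤ ρ`, `(11·4 + 4ρ + Mc + 3)·L ≤ c`, `Mc + 44 + 6ρ + 1 ≤ 2L^{c₀}`, `a′ + 3 ≤ c₀`), any guard `Adm` with the two displayed consequences, `2L ≤ R·(L·M_h) + 1`, `0 < B₃`, `0 ≤ κ`, and the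
FIVE numeric guards — on `a₀`: `243200·ℓ²·κ·L·a₀ ≤ 1`, `60·ℓ²·κ·L·a₀ < δ_N`; on `a₁`: MODULE 68's `δ_N`-guard, the frame budget `600ℓ·τ_c·a₁ ≤ 1`, the log range `X₀·a₁ ≤ ½` — the
`hQnear` binder of 89″∕90″ HOLDS VERBATIM at `β₁ := fun ε δ j ↦ L·(2·X₀·δ_j + 64·60800·ℓ²·(κ·ε_j·L)²)` (`ℓ = 6L`, `d = 4`; `X₀` of MODULE 98 at `d = 4`).
HONEST SCOPE: by-name composition (MODULE 98 + bookkeeping); the guards are the K0 assembler's numerics (all satisfiable by shrinking `a₀`, `a₁` AFTER `ρ`, `Mc`, `κ` — print (163) p. 304);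
`NrmDbarWideOfRecord` arrives through the binder (its door is CONDITIONAL on `HThm4RecDbar`, N05-REC — UNDISCHARGED); (d′) `hA1` and the budget row remain the token's displayed hypotheses;
nothing of [15]∕[6]∕[3]∕[III] ANALYSIS asserted beyond the cited lemmas; NO stub registered or closed here; K0⁷ ∕ K1⁹ NOT closed; N07 NOT discharged and NOT claimable; counts unmoved (typed 28∕28 ·
discharged 8∕27 per the chair); one finite 𝕋⁴ programme at fixed ε — the route closes the conditional finite-𝕋⁴ rung `BalabanLadder.UV` ONLY; the YM mass gap (Clay) is NOT proved by any of
this; nothing continuum ∕ ℝ⁴ ∕ OS.  No `def`, no `instance`, no `notation`, no `sorry`.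

References: [15] (144) p. 300, (147)–(157) pp. 301–302, (160) p. 303, (163) p. 304; [3] (26) p. 22, Prop. 4 (134)–(135) p. 38; [6] Lemma 1 (1.25) p. 79, p. 98, (1.131) p. 99;
[4] (2.1)–(2.3) p. 224; [III] (2.10)–(2.13) pp. 255–257; [I] (0.1) p. 251, (0.4), (0.11) p. 253.
-/

set_option autoImplicit false

noncomputable section

open scoped BigOperators Matrix.Norms.L2Operator

namespace Summit.QuantumFields.YangMills.BalabanUVNodes.N07DbarHQnear

open Literature.MathematicalPhysics.QuantumFieldTheory.Balaban1983to89
open Literature.MathematicalPhysics.QuantumFieldTheory.Balaban1983to89.Node00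
open Literature.MathematicalPhysics.QuantumFieldTheory.Balaban1983to89.B15DeterminingSets
open Literature.MathematicalPhysics.QuantumFieldTheory.Balaban1983to89.B12RegularSpaces111 (gaugeU expI grad)
open LatticeFieldCalculus (bondAvgIter)
open B15Eq112TorusCover (cover)
open B14DomainGeom (Pt Within)
open B5Eq117TorusCarriers (Mk)
open B5Eq118OneStroke (iterBlockOf)
open B8Eq131Cubes (sqLo sqHi box cube tLo tHi crad)
open B6SectADomainsV1 (Domains)
open B6SectAOperatorsV1 (BondIdx RE dsE QpE)
open Literature.MathematicalPhysics.QuantumFieldTheory.BalabanImbrieJaffe1984to88.BIJ85AxialPropagator411 (BondSpace)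
open T4Continuum (T4Family)
open GaugeField (gaugeAct)
open ExpMeanLog (deltaSU)
open Summit.QuantumFields.YangMills.Theorems.FlatCubeOpsText (Adm22)
open Summit.QuantumFields.YangMills.BalabanUVNodes.N07NormalisationDbarFramesWide (NrmDbarWideOfRecord)
open Summit.QuantumFields.YangMills.BalabanUVNodes.N07DbarCrossingEnds (adm22_meetCubeWide_trunc_seqOfRecord)
open Summit.QuantumFields.YangMills.BalabanUVNodes.N07DbarNearRowsQA (norm_bondAvgIter_le_of_near_of_data)
open Summit.QuantumFields.YangMills.BalabanUVNodes.N07DatumGauge152Guarded (numerics_cornerP_of_levelGuard two_mul_pow_le_sitesPerDir_of_levelGuard)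

variable (F : T4Family) (N : ℕ) [NeZero N]

/-- ★★★ **(c′)‴ IN BINDER FORM** (statement in the header): the `hQnear` letter of MODULES 82b∕89″∕90″ at `β₁ := fun ε δ j ↦ L·(2·X₀·δ_j + 64·60800·ℓ²·(κ·ε_j·L)²)`, from the structural
letters, the guard `Adm`'s two consequences and the five numeric guards on `a₀`, `a₁`.
[cite: Balaban1985Variational, (152)–(157) pp.301–302, (160) p.303, (163) p.304, (144) p.300, (147)–(150) p.301; Balaban1985Averaging, (26) p.22, Prop. 4 (134)–(135) p.38; Balaban1985RegularSpaces, Lemma 1 (1.25) p.79, p.98, (1.131) p.99; Balaban1984PropagatorsII, (2.1)–(2.3) p.224; Balaban1988Convergent, (2.10)–(2.13) pp.255–257] -/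
theorem hQnear_dbar_of_guards
    {ρ Mc Mh R a' c c₀ : ℕ} (hMc : 1 ≤ Mc) (hMha : Mh = F.L ^ a') (hdvd : F.L * Mh ∣ ρ) (hRρ : R * (F.L * Mh) ≤ ρ) (hLρ : F.L ≤ ρ)
    (hcfl : (11 * 4 + 4 * ρ + Mc + 3) * F.L ≤ c) (hc₀ : Mc + 11 * 4 + 6 * ρ + 1 ≤ 2 * F.L ^ c₀) (hac₀ : a' + 3 ≤ c₀)
    (Adm : StepGuard F) (hAdm₁ : ∀ (ν : Stage7Numerics) (M : ℕ) (g : ℕ → ℝ) (K k : ℕ) (s : SeqOfRecord F ν M g K k), Adm ν M g K k s → c ≤ ν.M₁ ∧ k + c₀ ≤ F.m + K)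
    (hAdm₂ : ∀ (ν : Stage7Numerics) (M : ℕ) (g : ℕ → ℝ) (K k : ℕ) (s : SeqOfRecord F ν M g K k), Adm ν M g K k s → ∀ j : ℕ, 1 ≤ j → j ≤ k →
      F.L * Mh ∣ M * RkOfRecord (F.P K).L ν.r (g j) ∧ dCubeSide (F.P K).L M (RkOfRecord (F.P K).L ν.r (g j)) j ∣ (F.P K).sitesPerDir 0)
    (hRM : 2 * F.L ≤ R * (F.L * Mh) + 1)
    {B₃ κ a₀ a₁ : ℝ} (hB₃ : 0 < B₃) (hκ : 0 ≤ κ)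
    -- the five numeric guards (the K0 assembler's choice of `a₀`, `a₁` after `ρ`, `Mc`, `κ`)
    (ha₀bud : 243200 * (((4 + 2) * F.L : ℕ) : ℝ) ^ 2 * (κ * a₀ * (F.L : ℝ)) ≤ 1)
    (ha₀gd : 60 * (((4 + 2) * F.L : ℕ) : ℝ) ^ 2 * (κ * a₀ * (F.L : ℝ)) < deltaSU (Fin N))
    (hguard : ((((4 + 2) * F.L : ℕ) : ℝ) ^ 2 / 4) * ((4 * (((4 - 1 : ℕ) : ℝ) * ((2 * F.L - 1 : ℕ) : ℝ)) + 1) * a₁) < deltaSU (Fin N))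
    (hτ : 600 * (((4 + 2) * F.L : ℕ) : ℝ) * (((4 * (F.L - 1) + 1 : ℕ) : ℝ) * ((((4 - 1 : ℕ) : ℝ) * ((F.L - 1 : ℕ) : ℝ)) * a₁)) ≤ 1)
    (hX : (2 * (((4 - 1 : ℕ) : ℝ) * ((crad (ρ * ((Mc + 11 * 4) / ρ + 2)) ρ : ℕ) : ℝ) * (1 + 2 * (((F.L : ℝ) ^ 2 + 6 * (((4 + 2) * F.L : ℕ) : ℝ) ^ 2) * (4 * (((4 - 1 : ℕ) : ℝ) * ((2 * F.L - 1 : ℕ) : ℝ)) + 1)))) + 10 * (((4 + 2) * F.L : ℕ) : ℝ) * (((4 * (F.L - 1) + 1 : ℕ) : ℝ) * (((4 - 1 : ℕ) : ℝ) * ((F.L - 1 : ℕ) : ℝ))) + 14 * ((((4 + 2) * F.L : ℕ) : ℝ) ^ 2 / 4 * (4 * (((4 - 1 : ℕ) : ℝ) * ((2 * F.L - 1 : ℕ) : ℝ)) + 1)) + 2 * (((4 + 1) * (F.L - 1) : ℕ) : ℝ) * (((4 * (F.L - 1) + 1 : ℕ) : ℝ) * (((4 - 1 : ℕ) : ℝ)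 * ((F.L - 1 : ℕ) : ℝ)))) * a₁ ≤ 1 / 2) :
        ∀ (ν : Stage7Numerics) (M : ℕ) (g : ℕ → ℝ) (K k : ℕ) (s : SeqOfRecord F ν M g K k), Sect2.SeqSeparated ν.M₁ s → 0 < ν.M₁ →
      Adm ν M g K k s → 1 ≤ k →
      ∀ (ε δ : ℕ → ℝ),
      (∀ n, n ≤ k → 0 < δ n ∧ δ n ≤ a₁) → (∀ n, n < k → δ n ≤ 2 * δ (n + 1)) → (∀ n, n < k → δ (n + 1) ≤ 2 * δ n) →
      (∀ n, n ≤ k → B₃ * δ n ≤ ε n ∧ ε n ≤ a₀) → (∀ n, n < k → ε n ≤ 2 * ε (n + 1)) → (∀ n, n < k → ε (n + 1) ≤ 2 * ε n) →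
      ∀ W : MSField (F.P K) (SU N), Sect2.DataSmall7PTop (avOfRecord F N K) s.Ω (suppDomOfRecord F ν K s.Ω) k δ W →
      ∀ U : GaugeField (F.P K) 0 (SU N),
      (∀ n, n ≤ k → PlaqSmallOn (Sect2.omegaPlaqsTop s.Ω (suppDomOfRecord F ν K s.Ω) n) (ε n * (F.P K).eta n ^ 2) U) →
      (∀ n, n ≤ k → Sect2.CoDivSmallOn (Sect2.omegaBondsTop s.Ω (suppDomOfRecord F ν K s.Ω) n) (ε n * (F.P K).eta n ^ 3) U) →
      AgreeOn (genSet s.Ω k) (avgFamily (avOfRecord F N K) U) W → IsCritOnFibre F N K (genSet s.Ω k) W U →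
      ∀ (n : ℕ) (hk : K - n ≤ (F.P K).m + (F.P K).K), 1 ≤ K - n → K - n ≤ k → ∀ (idx : Pt (F.P K).d),
      -- MEETING DATUMS ONLY: the print box has a point within `3` of a lift of a site of `Ω_{K−n}`
      (∃ x ∈ box (F.P K).L (cornerP (F.P K) Mc ρ idx) (sideP (F.P K) Mc ρ) (K - n), ∃ y : Pt (F.P K).d, cover (F.P K) y ∈ s.Ω (K - n) ∧ Within ((3 : ℕ) : ℤ) x y) →
      -- PRINT-MARGIN-CLEAN DATUMS ONLY (print p. 300 + (144)'s margin cube «□̃» = the print box WIDENED BY `2ρ` BLOCKS): top level, or «□̃» misses `Ω_{j+1}`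
      (K - n = k ∨ ∀ z ∈ box (F.P K).L (cornerP (F.P K) Mc ρ idx - ((2 * ρ : ℕ) : Pt (F.P K).d)) (sideP (F.P K) Mc ρ + 2 * (2 * ρ)) (K - n),
        cover (F.P K) z ∉ s.Ω (K - n + 1)) →
      -- THE FAMILY: print's (150) `Ω′_j = □_j (j < k), Ω′_k = □_k ∩ Ω_k`
      ∀ {HVd : Domains (F.P K)}
        (_ : HVd = domainsMeet (cubeDomains (F.P K) (cornerP (F.P K) Mc ρ idx) (sideP (F.P K) Mc ρ) ρ (K - n) hk) (domainsOfSeq s.Ω (K - n) hk))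
        (lo hi : ℕ → Pt (F.P K).d),
      lo 0 = (fun i => ((F.P K).L : ℤ) * (sqLo (F.P K).L (cornerP (F.P K) Mc ρ idx) ρ (K - n) 1 i - 1)) →
      hi 0 = (fun i => ((F.P K).L : ℤ) * (sqHi (F.P K).L (cornerP (F.P K) Mc ρ idx) (sideP (F.P K) Mc ρ) ρ (K - n) 1 i + 1) + (((F.P K).L : ℤ) - 1)) →
      (∀ j', 1 ≤ j' → lo j' = sqLo (F.P K).L (cornerP (F.P K) Mc ρ idx) ρ (K - n) j' - 1) →
      (∀ j', 1 ≤ j' → hi j' = sqHi (F.P K).L (cornerP (F.P K) Mc ρ idx) (sideP (F.P K) Mc ρ) ρ (K - n) j' + 1) →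
      ∀ (u : GaugeTransf (F.P K) 0 (SU N)) (A : PBond (F.P K) 0 → MatA N),
      (∀ b ∈ (Sect2.regionOfSet (F.P K) (cover (F.P K) '' box (F.P K).L (cornerP (F.P K) Mc ρ idx) (sideP (F.P K) Mc ρ) (K - n))).bonds,
        gaugeU (fun x => ιSU N (u x)) (fun b' => ιSU N (U b')) b = expI ((F.P K).eta (K - n)) (A b)) →
      -- (T1) the gauge equation on the WHOLE TOWER `□₀` of the datum
      (∀ b ∈ (Sect2.regionOfSet (F.P K) (cover (F.P K) '' cube (F.P K).L (cornerP (F.P K) Mc ρ idx) (sideP (F.P K) Mc ρ) ρ (K - n) 0)).bonds,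
        gaugeU (fun x => ιSU N (u x)) (fun b' => ιSU N (U b')) b = expI ((F.P K).eta (K - n)) (A b)) →
      -- (T2) (152)'s LEVEL-WEIGHTED letters on every `□_{j′}`, `j′ ≤ K − n`
      (∀ j', j' ≤ K - n →
        ∀ b ∈ (Sect2.regionOfSet (F.P K) (cover (F.P K) '' cube (F.P K).L (cornerP (F.P K) Mc ρ idx) (sideP (F.P K) Mc ρ) ρ (K - n) j')).bonds,
          ‖A b‖ < κ * ε (K - n) * ((F.P K).L : ℝ) ^ (K - n - j')) →
      (∀ b ∈ (Sect2.regionOfSet (F.P K) (cover (F.P K) '' box (F.P K).L (cornerP (F.P K) Mc ρ idx) (sideP (F.P K) Mc ρ) (K - n))).bonds,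
        ‖A b‖ < κ * ε (K - n)) →
      (∀ q ∈ (Sect2.regionOfSet (F.P K) (cover (F.P K) '' box (F.P K).L (cornerP (F.P K) Mc ρ idx) (sideP (F.P K) Mc ρ) (K - n))).dpairs,
        ‖grad ((F.P K).eta (K - n)) q.2.1 (fun y => A ⟨y, q.2.2⟩) q.1‖ < κ * ε (K - n)) →
      (∀ b ∈ Sect2.bondsDeep (cover (F.P K) '' box (F.P K).L (cornerP (F.P K) Mc ρ idx) (sideP (F.P K) Mc ρ) (K - n)),
        ‖Sect2.codiffCurlA ((F.P K).eta (K - n)) A b.src b.dir‖ < κ * ε (K - n)) →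
      (∀ b ∈ Sect2.bondsDeep (cover (F.P K) '' box (F.P K).L (cornerP (F.P K) Mc ρ idx) (sideP (F.P K) Mc ρ) (K - n)),
        ‖∑ ν' : Fin (F.P K).d, (((F.P K).eta (K - n) : ℝ) : ℂ)⁻¹ •
            (grad ((F.P K).eta (K - n)) ν' (fun y => A ⟨y, b.dir⟩) (b.src.unshift ν') - grad ((F.P K).eta (K - n)) ν' (fun y => A ⟨y, b.dir⟩) b.src)‖ <
          κ * ε (K - n)) →
      (∀ D' : Domains (F.P K), LinearMap.ker (QpE D') ≤ LinearMap.ker (QpE HVd) → ∀ φ : MatA N →L[ℂ] ℂ,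
        RE D' ((F.P K).eta (K - n))⁻¹ (dsE ((F.P K).eta (K - n))⁻¹ (WithLp.toLp 2 fun b => (φ (A b)).re : BondSpace (F.P K))) = 0 ∧
        RE D' ((F.P K).eta (K - n))⁻¹ (dsE ((F.P K).eta (K - n))⁻¹ (WithLp.toLp 2 fun b => (φ (A b)).im : BondSpace (F.P K))) = 0) →
      -- ★ THE NORMALISATION of this `u` (print's «ū_j = 1 on Λ′_j»), as delivered by HS3NORM
      NrmDbarWideOfRecord F N Mc ρ ν M g K k s U (K - n) idx u A →
      ∀ c : BondIdx HVd, ((c.1.1 : ℕ) = K - n ∨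
          (blockOf c.1.2.src ∈ (cubeDomains (F.P K) (cornerP (F.P K) Mc ρ idx) (sideP (F.P K) Mc ρ) ρ (K - n) hk).Om ((c.1.1 : ℕ) + 1) ∧
            blockOf c.1.2.tgt ∈ (cubeDomains (F.P K) (cornerP (F.P K) Mc ρ idx) (sideP (F.P K) Mc ρ) ρ (K - n) hk).Om ((c.1.1 : ℕ) + 1))) →
        ‖bondAvgIter (c.1.1 : ℕ) A c.1.2‖ ≤ (fun (ε δ : ℕ → ℝ) (j : ℕ) => (F.L : ℝ) * (2 * ((2 * (((4 - 1 : ℕ) : ℝ) * ((crad (ρ * ((Mc + 11 * 4) / ρ + 2)) ρ : ℕ) : ℝ) * (1 + 2 * (((F.L : ℝ) ^ 2 + 6 * (((4 + 2) * F.L : ℕ) : ℝ) ^ 2) * (4 * (((4 - 1 : ℕ) : ℝ) * ((2 * F.L - 1 : ℕ) : ℝ)) + 1)))) + 10 * (((4 + 2) * F.L : ℕ) : ℝ) * (((4 * (F.L - 1) + 1 : ℕ) : ℝ) * (((4 - 1 : ℕ) : ℝ) * ((F.L - 1 : ℕ) : ℝ))) + 14 * ((((4 + 2) * F.L : ℕ)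 : ℝ) ^ 2 / 4 * (4 * (((4 - 1 : ℕ) : ℝ) * ((2 * F.L - 1 : ℕ) : ℝ)) + 1)) + 2 * (((4 + 1) * (F.L - 1) : ℕ) : ℝ) * (((4 * (F.L - 1) + 1 : ℕ) : ℝ) * (((4 - 1 : ℕ) : ℝ) * ((F.L - 1 : ℕ) : ℝ)))) * δ j) + 64 * 60800 * (((4 + 2) * F.L : ℕ) : ℝ) ^ 2 * (κ * ε j * (F.L : ℝ)) ^ 2)) ε δ (K - n) := by
  intro ν M g K k s hsep hM₁ hadm hk1 ε δ hδ hcompδ hcompδ' hε hεc hεc' W h7 U h17 h19 hfib hcrit n hk hk1' hjk idx hmeet hclean HVd hHVd lo hi hlo0 hhi0 hloj hhij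
    u A hbox hT1 hT2 hAbox hgrad hcodiff hcurl hLandau hN cI hnear
  subst hHVd
  -- the guard's consequences
  obtain ⟨hcM, hlev⟩ := hAdm₁ ν M g K k s hadm
  have hgrid2 := hAdm₂ ν M g K k s hadm
  have hPd : (F.P K).d = 4 := rfl
  have hPL : (F.P K).L = F.L := rfl
  have hPm : (F.P K).m = F.m := rfl
  have hPK : (F.P K).K = K := rfl
  have hL1 : 1 ≤ F.L := by have := F.hL11; omega
  have hkK : k ≤ (F.P K).m + (F.P K).K := by rw [hPm, hPK]; omega
  have hgrid : ∀ j : ℕ, 1 ≤ j → j ≤ k → dCubeSide (F.P K).L M (RkOfRecord (F.P K).L ν.r (g j)) j ∣ (F.P K).sitesPerDir 0 := fun j h1 hj => (hgrid2 j h1 hj).2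
  have hρ1 : 1 ≤ ρ := le_trans hL1 hLρ
  have hLρ' : (F.P K).L ≤ ρ := by rw [hPL]; exact hLρ
  have hfloor : (11 * (F.P K).d + 4 * ρ + Mc) * (F.P K).L + 3 ≤ ν.M₁ := by
    rw [hPd, hPL]
    have e : (11 * 4 + 4 * ρ + Mc + 3) * F.L = (11 * 4 + 4 * ρ + Mc) * F.L + 3 * F.L := by ring
    have h3 : 3 ≤ 3 * F.L := by omega
    omega
  have hjK : K - n + 1 ≤ (F.P K).m + (F.P K).K := by rw [hPm, hPK]; omega
  -- the window's non-wrapping from the level guard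
  have hside : sideP (F.P K) Mc ρ ≤ Mc + 11 * 4 + 2 * ρ := by
    unfold sideP; rw [hPd, Nat.mul_add]
    have := Nat.mul_div_le (Mc + 11 * 4) ρ
    omega
  have h2pow : 2 * (F.P K).L ^ c₀ ≤ (F.P K).sitesPerDir (K - n) := two_mul_pow_le_sitesPerDir_of_levelGuard (P := F.P K) hjk (by rw [hPm, hPK]; exact hlev)
  have hn : ∀ κ', (tHi (cornerP (F.P K) Mc ρ idx) (sideP (F.P K) Mc ρ) ρ) κ' ≤ (tLo (cornerP (F.P K) Mc ρ idx) ρ) κ' + (sideP (F.P K) Mc ρ + 4 * ρ - 1 : ℕ) := by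
    intro κ'
    have hS1 : 1 ≤ sideP (F.P K) Mc ρ := by have := le_sideP (P := F.P K) Mc hρ1; omega
    simp only [tHi, tLo]
    omega
  have hnN : (sideP (F.P K) Mc ρ + 4 * ρ - 1 : ℕ) + 1 < (F.P K).sitesPerDir (K - n) := by
    rw [hPL] at h2pow; omega
  -- `Adm22 D̃ R (L·M_h)` (MODULE 93's named instance with the datum's grid numerics)
  have hnum := numerics_cornerP_of_levelGuard F (Mc := Mc) hk1' hjk hlev hMha (by omega) hLρ' hdvd (by omega) idx
  obtain ⟨ha, hM, hper, -⟩ := hnum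
  have hLMh : 1 ≤ F.L * Mh := by
    rw [hMha]; exact Nat.one_le_iff_ne_zero.mpr (Nat.mul_ne_zero (by omega) (pow_ne_zero _ (by omega)))
  have hν1 : 1 ≤ ν.M₁ := hM₁
  have hRsep : R * (F.L * Mh) + 1 ≤ (F.P K).L * ν.M₁ := by
    rw [hPL]
    have h1 : ν.M₁ ≤ F.L * ν.M₁ := Nat.le_mul_of_pos_left _ hL1
    have h2 : ρ + 1 ≤ c := by
      have : 11 * 4 + 4 * ρ + Mc + 3 ≤ (11 * 4 + 4 * ρ + Mc + 3) * F.L := Nat.le_mul_of_pos_right _ hL1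
      omega
    omega
  have hgran : ∀ j' : ℕ, 1 ≤ j' → j' ≤ K - n → F.L * Mh ∣ M * RkOfRecord (F.P K).L ν.r (g j') := fun j' h1 hj' => (hgrid2 j' h1 (hj'.trans hjk)).1
  have hdiv : ∀ j' : ℕ, 1 ≤ j' → j' ≤ K - n → dCubeSide (F.P K).L M (RkOfRecord (F.P K).L ν.r (g j')) j' ∣ (F.P K).sitesPerDir 0 :=
    fun j' h1 hj' => hgrid j' h1 (hj'.trans hjk)
  have hAdmW := adm22_meetCubeWide_trunc_seqOfRecord ν M g K k s hjk hk hLMh hν1 hRsep hsep hdiv hgran hdvd ha hM hper hRρ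
  have hRM' : 2 * (F.P K).L ≤ R * (F.L * Mh) + 1 := by rw [hPL]; exact hRM
  -- the letters at the datum's level
  have hδj : 0 < δ (K - n) := (hδ (K - n) hjk).1
  have hεj0 : 0 ≤ ε (K - n) := le_trans (by positivity : 0 ≤ B₃ * δ (K - n)) (hε (K - n) hjk).1
  have hεa : ε (K - n) ≤ a₀ := (hε (K - n) hjk).2
  have hℓ0 : (0 : ℝ) ≤ (((4 + 2) * F.L : ℕ) : ℝ) := Nat.cast_nonneg _
  have hsm : κ * ε (K - n) * (F.L : ℝ) ≤ κ * a₀ * (F.L : ℝ) :=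
    mul_le_mul_of_nonneg_right (mul_le_mul_of_nonneg_left hεa hκ) (Nat.cast_nonneg _)
  have hbud : 243200 * ((((F.P K).d + 2) * (F.P K).L : ℕ) : ℝ) ^ 2 * (κ * ε (K - n) * ((F.P K).L : ℝ)) ≤ 1 := by
    rw [hPd, hPL]
    exact (mul_le_mul_of_nonneg_left hsm (by positivity)).trans ha₀bud
  have hgd : 60 * ((((F.P K).d + 2) * (F.P K).L : ℕ) : ℝ) ^ 2 * (κ * ε (K - n) * ((F.P K).L : ℝ)) < deltaSU (Fin N) := by
    rw [hPd, hPL]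
    exact lt_of_le_of_lt (mul_le_mul_of_nonneg_left hsm (by positivity)) ha₀gd
  -- MODULE 98 at the datum
  have h98 := norm_bondAvgIter_le_of_near_of_data F N s hsep hkK hgrid hMc hρ1 hLρ' hfloor hδ hcompδ (by rw [hPd, hPL]; exact hguard) (by rw [hPd, hPL]; exact hτ)
    (by rw [hPd, hPL]; unfold sideP; rw [hPd]; exact hX) W h7 U hfib hk1' hjk hjK idx hmeet hclean hn hnN u A hκ hεj0 hT1 hT2 hbud hgd hk hN hAdmW hRM' cI hnear
  refine h98.trans (le_of_eq ?_)
  simp only [hPd, hPL, sideP]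

end Summit.QuantumFields.YangMills.BalabanUVNodes.N07DbarHQnear

end
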